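import Literature.AlgebraicGeometry.Resolution.ArithmeticalThreefolds
import Literature.AlgebraicGeometry.Resolution.AffineDomainDimension
import Literature.AlgebraicGeometry.Resolution.ZariskiFiniteness
import Mathlib.Algebra.Field.Subfield.Basic
import HarnessLib

/-!
# Affine models inside valuation rings and finite resolving systems from (LU)

Topic: `Literature/AlgebraicGeometry/Resolution`. Inputs of Zariski's patching programme
(Zariski–Samuel II, Ch. VI §17; Cossart–Piltant 2019, proof of Prop. 4.6 [arXiv v1: 4.4],
Step 3), all PROVED:

* `exists_fg_le_valuationSubring` — every valuation ring `𝒪 ∋ k` of a function field `K/k`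
  contains a finitely generated `k`-subalgebra `A` with `Frac A = K` (invert the generators of a
  given affine model lying outside `𝒪`);
* `LocalUniformization3.exists_hasRegularCentre` — hence `LocalUniformization3 k`
  (`ArithmeticalThreefolds.lean`) uniformizes EVERY valuation ring of a function field of
  transcendence degree `≤ 3` on a finitely generated affine model `T ⊆ 𝒪_v` with `Frac T = K`
  (`ZariskiRiemannSpace.HasRegularCentre T v`), the dimension bound coming from the dimension
  theorem (`ringKrullDim_le_of_fg_of_trdeg_le`);
* `exists_finite_resolvingSystem'` — Zariski's finiteness theorem
  (`ZariskiRiemannSpace.exists_finite_resolvingSystem`) with a side condition on the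
  uniformizing algebras carried along (here: `Frac T = K`);
* `le_two_or_eq_three_of_le_three` — arithmetic of `topologicalKrullDim`.

## References

* O. Zariski, P. Samuel, *Commutative Algebra* II, Ch. VI §17, Thm. 40. [ZariskiSamuel1960]
* V. Cossart, O. Piltant, J. Algebra 529 (2019), proof of Prop. 4.6 (arXiv:1412.0868v1:
  Prop. 4.4), Step 3. [CossartPiltant2019]
* H. Matsumura, *Commutative Ring Theory*, Thm. 5.6. [Matsumura1987]
-/

noncomputable section

open IsLocalRing

namespace Literature.AlgebraicGeometry.Resolution

universe u

/-! ## Affine models inside a valuation ring -/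

section AffineModels

variable {k K : Type u} [Field k] [Field K] [Algebra k K]

/-- **Every valuation ring of a function field contains a finitely generated affine model of
it**: if `K = Frac A₀` with `A₀ = k[a₁, …, aₘ]` and `𝒪 ∋ k` is a valuation ring of `K`, then
`A := k[b₁, …, bₘ] ⊆ 𝒪`, `bᵢ := aᵢ` or `aᵢ⁻¹` according as `aᵢ ∈ 𝒪` or not, is a finitely
generated `k`-subalgebra of `𝒪` with `Frac A = K` (the subfield generated by `A` contains every
`aᵢ`). (Zariski–Samuel II, Ch. VI §17: every place of `K/k` has a centre on some affine model.)
[cite: ZariskiSamuel1960, Ch. VI §17] -/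
theorem exists_fg_le_valuationSubring (A₀ : Subalgebra k K) (h0 : A₀.FG) [IsFractionRing A₀ K]
    (O : ValuationSubring K) (hk : ∀ c : k, algebraMap k K c ∈ O) :
    ∃ A : Subalgebra k K, A.FG ∧ A.toSubring ≤ O.toSubring ∧ IsFractionRing A K := by
  classical
  obtain ⟨s, hs⟩ := h0
  let f : K → K := fun a => if a ∈ O then a else a⁻¹
  let s' : Finset K := s.image f
  have hf : ∀ a, f a ∈ O := by
    intro a
    by_cases h : a ∈ O
    · simp only [f, h, if_true]
    · simp only [f, h, if_false]
      exact (O.mem_or_inv_mem a).resolve_left h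
  have hs'O : ∀ b ∈ s', b ∈ O := by
    intro b hb
    obtain ⟨a, -, rfl⟩ := Finset.mem_image.mp hb
    exact hf a
  let A : Subalgebra k K := Algebra.adjoin k (s' : Set K)
  let O' : Subalgebra k K :=
    { O.toSubring.toSubsemiring with
      algebraMap_mem' := fun c => hk c }
  have hAO : A.toSubring ≤ O.toSubring := by
    have h : A ≤ O' := Algebra.adjoin_le fun b hb => hs'O b hb
    exact h
  refine ⟨A, ⟨s', rfl⟩, hAO, ?_⟩
  -- the subfield generated by `A` is everything
  let F : Subfield K := Subfield.closure (A : Set K)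
  have hAF : (A : Set K) ⊆ F := Subfield.subset_closure
  have hsF : (s : Set K) ⊆ F := by
    intro a ha
    have hfa : f a ∈ F :=
      hAF (Algebra.subset_adjoin (Finset.mem_coe.mpr (Finset.mem_image.mpr ⟨a, ha, rfl⟩)))
    by_cases h : a ∈ O
    · have e : f a = a := if_pos h
      rw [e] at hfa
      exact hfa
    · have e : f a = a⁻¹ := if_neg h
      rw [e] at hfa
      have := F.inv_mem hfa
      rw [inv_inv] at this
      exact this
  let F' : Subalgebra k K :=
    { F.toSubring.toSubsemiring with
      algebraMap_mem' := fun c => hAF (A.algebraMap_mem c) }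
  have hA0F : (A₀ : Set K) ⊆ F := by
    have h : Algebra.adjoin k (s : Set K) ≤ F' := Algebra.adjoin_le hsF
    rw [hs] at h
    exact h
  have hF : F = ⊤ := by
    rw [eq_top_iff]
    intro z _
    obtain ⟨a, b, -, rfl⟩ := IsFractionRing.div_surjective (A := A₀) z
    exact F.div_mem (hA0F a.2) (hA0F b.2)
  refine IsFractionRing.of_field A K fun z => ?_
  have hz : z ∈ Subfield.closure (A : Set K) := by
    change z ∈ F
    rw [hF]
    trivial
  obtain ⟨y, hy, w, hw, rfl⟩ := Subfield.mem_closure_iff.mp hz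
  have hcl : Subring.closure (A : Set K) = A.toSubring := Subring.closure_eq A.toSubring
  rw [hcl] at hy hw
  exact ⟨⟨y, hy⟩, ⟨w, hw⟩, rfl⟩

/-- **Local uniformization in dimension `≤ 3` uniformizes every valuation of a function field
of transcendence degree `≤ 3` on a finitely generated affine MODEL** (an affine `T ⊆ 𝒪_v`
with `Frac T = K`, regular at the centre `𝔪_v ∩ T`): apply `LocalUniformization3 k` to an
affine model of `K` inside `𝒪_v` (`exists_fg_le_valuationSubring`), whose dimension is `≤ 3`
by the dimension theorem (`ringKrullDim_le_of_fg_of_trdeg_le`). This is hypothesis (LU) as it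
enters Cossart–Piltant's Step 3 / Piltant's Axiom 5.
[cite: CossartPiltant2019, Prop. 4.6 (arXiv v1: Prop. 4.4), proof, Step 3] -/
theorem LocalUniformization3.exists_hasRegularCentre (hLU : LocalUniformization3 k)
    (A₀ : Subalgebra k K) (h0 : A₀.FG) [IsFractionRing A₀ K] (htr : Algebra.trdeg k K ≤ 3)
    (v : ZariskiRiemannSpace k K) :
    ∃ T : Subalgebra k K, (T.FG ∧ IsFractionRing T K) ∧
      ZariskiRiemannSpace.HasRegularCentre T v := by
  obtain ⟨A, hAfg, hAO, hAfr⟩ :=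
    exists_fg_le_valuationSubring A₀ h0 v.asValuationSubring v.algebraMap_mem
  haveI := hAfr
  have hdim : ringKrullDim A ≤ (3 : ℕ) :=
    ringKrullDim_le_of_fg_of_trdeg_le A hAfg (by exact_mod_cast htr)
  obtain ⟨T, hTO, hle, hTfg, hreg⟩ := hLU K v.asValuationSubring A hAO hAfg hAfr
    (by exact_mod_cast hdim)
  exact ⟨T, ⟨hTfg, isFractionRing_of_le hle hAfr⟩, hTO, hreg⟩

/-- Zariski's finiteness theorem with a side condition on the uniformizing algebras carried
along (a variant of `ZariskiRiemannSpace.exists_finite_resolvingSystem`: the finite subcover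
consists of algebras produced by the hypothesis, so any property `P` they all have persists).
[cite: ZariskiSamuel1960, Ch. VI §17, Thm. 40] -/
theorem exists_finite_resolvingSystem' {P : Subalgebra k K → Prop}
    (hJ : ∀ T : Subalgebra k K, T.FG → IsOpen (regularLocus T))
    (hLU : ∀ v : ZariskiRiemannSpace k K, ∃ T : Subalgebra k K, (T.FG ∧ P T) ∧
      ZariskiRiemannSpace.HasRegularCentre T v) :
    ∃ 𝒯 : Finset (Subalgebra k K), (∀ T ∈ 𝒯, T.FG ∧ P T) ∧
      ∀ w : ZariskiRiemannSpace k K, ∃ T ∈ 𝒯, ZariskiRiemannSpace.HasRegularCentre T w := by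
  classical
  choose T hT using hLU
  let U : ZariskiRiemannSpace k K → Set (ZariskiRiemannSpace k K) := fun w =>
    {u | ZariskiRiemannSpace.HasRegularCentre (T w) u}
  have hUo : ∀ w, IsOpen (U w) := fun w =>
    ZariskiRiemannSpace.isOpen_setOf_hasRegularCentre (hT w).1.1 (hJ _ (hT w).1.1)
  have hUmem : ∀ w, w ∈ U w := fun w => (hT w).2
  obtain ⟨t, ht⟩ := CompactSpace.elim_nhds_subcover U fun w => (hUo w).mem_nhds (hUmem w)
  refine ⟨t.image T, ?_, fun w => ?_⟩
  · intro S hS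
    obtain ⟨w, -, rfl⟩ := Finset.mem_image.mp hS
    exact (hT w).1
  · have hw : w ∈ ⋃ x ∈ t, U x := by rw [ht]; trivial
    obtain ⟨x, hxt, hwx⟩ := Set.mem_iUnion₂.mp hw
    exact ⟨T x, Finset.mem_image_of_mem T hxt, hwx⟩

end AffineModels

/-! ## Dimension bookkeeping -/

/-- `d ≤ 3 ⇒ d ≤ 2 ∨ d = 3` in `WithBot ℕ∞`. [folklore] -/
theorem le_two_or_eq_three_of_le_three {d : WithBot ℕ∞} (h : d ≤ 3) : d ≤ 2 ∨ d = 3 := by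
  have h2 : d ≤ ((3 : ℕ∞) : WithBot ℕ∞) := h
  induction d using WithBot.recBotCoe with
  | bot => exact Or.inl bot_le
  | coe a =>
    have ha : a ≤ (3 : ℕ∞) := WithBot.coe_le_coe.mp h2
    induction a using ENat.recTopCoe with
    | top => exact absurd (top_le_iff.mp ha) (by simp)
    | coe n =>
      have hn : n ≤ 3 := by exact_mod_cast ha
      rcases Nat.lt_or_ge n 3 with hlt | hge
      · have h1 : (n : ℕ∞) ≤ (2 : ℕ∞) := by exact_mod_cast (show n ≤ 2 by omega)
        exact Or.inl (WithBot.coe_le_coe.mpr h1)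
      · obtain rfl : n = 3 := le_antisymm hn hge
        exact Or.inr rfl

end Literature.AlgebraicGeometry.Resolution

end
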